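import Literature.AlgebraicGeometry.HodgeTheory.CMCurveTimesSimpleCMSurfaceStablyNondegenerate
import Literature.AlgebraicGeometry.HodgeTheory.CurveTimesSimpleSurfaceStablyNondegenerate
import Literature.AlgebraicGeometry.HodgeTheory.EllipticCurvesProductsStablyNondegenerate
import Literature.AlgebraicGeometry.HodgeTheory.SimpleAbelianThreefoldPowersHodgeClasses
import Literature.AlgebraicGeometry.Motives.AbelianVarietyIsogenousProductOfSimples
import Literature.AlgebraicGeometry.Milne1999.CodesHCOfCMHodgeHypothesis
import HarnessLib

/-!
# EVERY complex abelian THREEFOLD is stably nondegenerate (Moonen–Zarhin 1999 Thm. 0.1 (4) in dimension 3), PROVED: the Hodge conjecture for every power of every complex abelian threefold, unconditionally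

Family `hodge`, layer `Literature/AlgebraicGeometry/HodgeTheory`. Research context: cell `pub-hodge-ring2`
(HONEST FRAMING: research route conditional on HC_CM; not a corollary; Q11.4-sentence-2 already refuted in
dim ≥ 3), Literature lane (lit seat, generations 52–53, programme R20 «every abelian threefold»). Theorems only, no
definition, no named fact; HC_CM (`Milne1999.CMHodgeHypothesisAt`, the cell's hypothesis) occurs ONCE, as an
explicit binder of §3's last theorem, and is never asserted — and by §4 it is NOT NEEDED in dimension `3`; no step
towards a summit statement.

PUBLISHED STATEMENT. Moonen–Zarhin, Math. Ann. 315 (1999), Thm. 0.1: «Let `X` be a complex abelian variety with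
`dim(X) ≤ 4`. […] (4) Suppose we are not in one of the cases (a), (b), (c) or (d). Then `Hg(X) = Sp_D(V,φ)` and
`B•(Xⁿ) = D•(Xⁿ)` for all `n`», the four exceptional cases (a)–(d) all having `dim X = 4` [corpus:
paper:arxiv-math_9901113 p. 1]: EVERY complex abelian threefold satisfies condition (D). By Poincaré's complete
reducibility a threefold is simple, or isogenous to `E × S` with `E` an elliptic curve and `S` an abelian surface.
The tree has: simple threefolds (`AbelianVariety.isStablyNondegenerate_of_isSimple_of_dim_three`, Moonen–Zarhin
(2.3) / Tankeev–Ribet at `p = 3`); `E × S` for `S` simple unless `E`, `S` are both of CM type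
(`isStablyNondegenerate_curve_prod_of_isSimple_surface_of_not_and_isOfCMType`, programmes R16/R15); `E × S` for
`S` not simple (`isStablyNondegenerate_curve_prod_surface_of_not_isSimple`, Tate / van Geemen Thm. 4.3 stably).
§§1–3 (generation 52) display the row `E_k × S` with `E_k` a CM elliptic curve and `S` a SIMPLE CM surface as an
explicit hypothesis; §4 (generation 53) discharges it by the tree's
`isStablyNondegenerate_cmCurve_prod_of_isSimple_surface_of_isOfCMType` (`HodgeTheory/CMCurveTimesSimpleCMSurfaceStablyNondegenerate`:
Moonen–Zarhin Prop. (3.8) and (5.2) in CM form — a simple CM surface has a primitive quartic CM type, so its CM field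
contains no imaginary quadratic field, the foreign-slot criterion gives `Hg(E × S) = Hg(E) × Hg(S)`, and Moonen–Zarhin
(3.1) gives the product-span property on all `E^{N+1} × S^{N+1}`).

RESULTS.
* §1 `exists_curve_prod_surface_isIsogenous_of_not_isSimple_threefold` — a non-simple abelian threefold is
  isogenous to `E × S`, `dim E = 1`, `dim S = 2` (Poincaré, the tree's `poincare_complete_reducibility`).
* §2 **`isStablyNondegenerate_of_dim_eq_three_of_not_isOfCMType (hX3 : X.dim = 3) (hcm : ¬ IsOfCMType X)`** —
  UNCONDITIONAL: every non-CM abelian threefold has `B = D` on all its powers (if `X ∼ E × S` with `E`, `S` both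
  CM then `X` is of CM type: `IsOfCMType.prod`, `.of_isIsogeny`); `isStablyNondegenerate_or_of_dim_eq_three` (the
  census dichotomy: (D), or non-simple of CM type); `isStablyNondegenerate_of_dim_eq_three_of` — ALL threefolds,
  with the row «`E_k × S`, `S` simple CM» as the ONE displayed hypothesis.
* §3 the Hodge conjecture for every power of a non-CM threefold (UNCONDITIONAL), and — the cell's framing —
  HC_CM ⟹ the Hodge conjecture for every power `X^{N+1}` of EVERY complex abelian threefold
  (`hodgeConjectureFor_powSucc_of_dim_eq_three_of_cmHodgeHypothesis`; superseded by §4).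
* §4 **`isStablyNondegenerate_of_dim_eq_three (hX3 : X.dim = 3)`** — EVERY complex abelian threefold is stably
  nondegenerate, binder-free; `isStablyNondegenerate_of_dim_pos_of_dim_le_three` (dimensions `1, 2, 3`); and,
  UNCONDITIONALLY, **the Hodge conjecture for every power of every complex abelian threefold**
  (`hodgeConjectureFor_powSucc_of_dim_eq_three`, `hodgeConjectureFor_of_dim_eq_three`,
  `hodgeConjectureFor_of_isIsogenous_powSucc_of_dim_eq_three`, `hodgeConjectureFor_powSucc_of_dim_pos_of_dim_le_three`).

## References
* [MoonenZarhin1999LowDim] B. Moonen, Yu. Zarhin, Math. Ann. 315 (1999) 711–733: Thm. 0.1 (4), §2 (2.1)–(2.3),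
  §3 Thm. (3.2), Prop. (3.8), Cor. (3.9), (5.2) [corpus: paper:arxiv-math_9901113 pp. 1, 5–8]. [cite: MoonenZarhin1999LowDim, Thm. 0.1 (4)]
* [MumfordAV1970] D. Mumford, *Abelian Varieties* (1970), §19 Thm. 1 and Cor. 1 (pp. 173–174). [cite: MumfordAV1970, §19 Thm. 1 (pp. 173–174)]
* [vanGeemen1994HodgeAV] B. van Geemen, LNM 1594 (1994), Thm. 4.3, Lemma 3.7, §2.4. [cite: vanGeemen1994HodgeAV, Thm. 4.3 and Lemma 3.7]
* [Milne1999] J. S. Milne, Compositio Math. 117 (1999), §2 p. 54 (CM type), §7 (the hypothesis HC_CM). [cite: Milne1999, §7 p. 72]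
* [Hazama1989] F. Hazama, Duke Math. J. 58 (1989) 31–37. [cite: Hazama1989, Thm. (= Gordon 7.6.2)]
-/

noncomputable section

open CategoryTheory CategoryTheory.Limits Module

namespace Literature.AlgebraicGeometry.HodgeTheory

open Literature.AlgebraicGeometry.Motives (AbelianVariety)
open Literature.AlgebraicGeometry.Motives.AbelianVariety
open Literature.AlgebraicGeometry.Milne1999
open Literature.Barriers.HodgeConjecture

variable {X : AbelianVariety ℂ}

/-! ### §1 Poincaré: a non-simple threefold is `E × S` up to isogeny -/

/-- **A non-simple complex abelian threefold is isogenous to a product `E × S` of an elliptic curve and an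
abelian surface** (Poincaré's complete reducibility: an abelian subvariety `B ↪ X` with `0 < dim B < 3` and its
complement `Z`, `B × Z → X` an isogeny, `{dim B, dim Z} = {1, 2}`). [cite: MumfordAV1970, §19 Thm. 1 (pp. 173–174)]
[cite: MoonenZarhin1999LowDim, Thm. 0.1] -/
theorem exists_curve_prod_surface_isIsogenous_of_not_isSimple_threefold (hX3 : X.dim = 3) (hX : ¬ X.IsSimple) :
    ∃ E S : AbelianVariety ℂ, E.dim = 1 ∧ S.dim = 2 ∧ AbelianVariety.IsIsogenous (E.prod S) X := by
  obtain ⟨B, f, hf, hB0, hBX⟩ := exists_abelianSubvariety_of_not_isSimple hX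
  haveI := hf
  obtain ⟨Z, j, hj, hσ⟩ := poincare_complete_reducibility f
  haveI := hj
  have hdim : B.dim + Z.dim = X.dim := by
    rw [← dim_prod, ← dim_eq_of_isIsogeny (isIsogeny_hom_of_iso (biprodIsoProd B Z)), dim_eq_of_isIsogeny hσ]
  rcases Nat.lt_or_ge B.dim 2 with hB1 | hB2
  · refine ⟨B, Z, by omega, by omega, (biprodIsoProd B Z).inv ≫ biprod.desc f j, ?_⟩
    exact isIsogeny_comp (isIsogeny_hom_of_iso (biprodIsoProd B Z).symm) hσ
  · obtain ⟨Z', j', -, hσ'⟩ := poincare_complete_reducibility j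
    have hdim' : Z.dim + Z'.dim = X.dim := by
      rw [← dim_prod, ← dim_eq_of_isIsogeny (isIsogeny_hom_of_iso (biprodIsoProd Z Z')), dim_eq_of_isIsogeny hσ']
    refine ⟨Z, Z', by omega, by omega, (biprodIsoProd Z Z').inv ≫ biprod.desc j j', ?_⟩
    exact isIsogeny_comp (isIsogeny_hom_of_iso (biprodIsoProd Z Z').symm) hσ'

/-! ### §2 Condition (D) for abelian threefolds -/

/-- **MOONEN–ZARHIN Thm. 0.1 (4) IN DIMENSION 3, modulo one CM row: every complex abelian threefold is stably
nondegenerate, GIVEN the row «`E × S` for `E` a CM elliptic curve and `S` a SIMPLE abelian surface of CM type»**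
(displayed as the hypothesis `hR19`; Moonen–Zarhin assert it — a simple CM surface has a primitive quartic CM field
of endomorphisms, which contains no imaginary quadratic field — but its CM torus computation is not in the tree).
Cases: `X` simple (`AbelianVariety.isStablyNondegenerate_of_isSimple_of_dim_three`); `X ∼ E × S` with `S` not
simple (`isStablyNondegenerate_curve_prod_surface_of_not_isSimple`); `S` simple, not both CM
(`isStablyNondegenerate_curve_prod_of_isSimple_surface_of_not_and_isOfCMType`); both CM (`hR19`).
[cite: MoonenZarhin1999LowDim, Thm. 0.1 (4) and §3 Thm. (3.2)] [cite: MumfordAV1970, §19 Thm. 1 (pp. 173–174)]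
[cite: vanGeemen1994HodgeAV, Thm. 4.3 and §3.6] -/
theorem isStablyNondegenerate_of_dim_eq_three_of
    (hR19 : ∀ E S : AbelianVariety ℂ, E.dim = 1 → S.dim = 2 → S.IsSimple → IsOfCMType E → IsOfCMType S →
      IsStablyNondegenerate (E.prod S))
    (hX3 : X.dim = 3) : IsStablyNondegenerate X := by
  by_cases hs : X.IsSimple
  · exact AbelianVariety.isStablyNondegenerate_of_isSimple_of_dim_three X hs hX3
  obtain ⟨E, S, hE, hS2, hiso⟩ := exists_curve_prod_surface_isIsogenous_of_not_isSimple_threefold hX3 hs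
  by_cases hS : S.IsSimple
  · by_cases hboth : IsOfCMType E ∧ IsOfCMType S
    · exact (hR19 E S hE hS2 hS hboth.1 hboth.2).of_isIsogenous' hiso
    · exact (isStablyNondegenerate_curve_prod_of_isSimple_surface_of_not_and_isOfCMType hE hS hS2 hboth).of_isIsogenous'
        hiso
  · exact (isStablyNondegenerate_curve_prod_surface_of_not_isSimple hE hS2 hS).of_isIsogenous' hiso

/-- **UNCONDITIONAL: every complex abelian threefold NOT of CM type is stably nondegenerate** — `B = D` on all
its powers. (If `X ∼ E × S` with `E` and `S` both of CM type then `X` is of CM type — `IsOfCMType.prod`,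
`IsOfCMType.of_isIsogeny` — so the CM row is never met.) [cite: MoonenZarhin1999LowDim, Thm. 0.1 (4) and §3 Thm. (3.2)]
[cite: MumfordAV1970, §19 Thm. 1 (pp. 173–174)] [cite: Milne1999, §2 p. 54] -/
theorem isStablyNondegenerate_of_dim_eq_three_of_not_isOfCMType (hX3 : X.dim = 3) (hcm : ¬ IsOfCMType X) :
    IsStablyNondegenerate X := by
  by_cases hs : X.IsSimple
  · exact AbelianVariety.isStablyNondegenerate_of_isSimple_of_dim_three X hs hX3
  obtain ⟨E, S, hE, hS2, hiso⟩ := exists_curve_prod_surface_isIsogenous_of_not_isSimple_threefold hX3 hs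
  by_cases hS : S.IsSimple
  · have hboth : ¬ (IsOfCMType E ∧ IsOfCMType S) := by
      rintro ⟨hEcm, hScm⟩
      obtain ⟨g, hg⟩ := hiso
      exact hcm ((hEcm.prod hScm).of_isIsogeny hg)
    exact (isStablyNondegenerate_curve_prod_of_isSimple_surface_of_not_and_isOfCMType hE hS hS2 hboth).of_isIsogenous' hiso
  · exact (isStablyNondegenerate_curve_prod_surface_of_not_isSimple hE hS2 hS).of_isIsogenous' hiso

/-- **The census dichotomy for abelian threefolds**: a complex abelian threefold is stably nondegenerate, OR it is
non-simple and of CM type (isogenous to `E_k × S` with `S` a simple CM surface or to a product of three CM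
elliptic curves — the latter again stably nondegenerate, `isStablyNondegenerate_curve_prod_curve_prod_curve`).
[cite: MoonenZarhin1999LowDim, Thm. 0.1 (4)] -/
theorem isStablyNondegenerate_or_of_dim_eq_three (hX3 : X.dim = 3) :
    IsStablyNondegenerate X ∨ (¬ X.IsSimple ∧ IsOfCMType X) := by
  by_cases hs : X.IsSimple
  · exact Or.inl (AbelianVariety.isStablyNondegenerate_of_isSimple_of_dim_three X hs hX3)
  by_cases hcm : IsOfCMType X
  · exact Or.inr ⟨hs, hcm⟩
  · exact Or.inl (isStablyNondegenerate_of_dim_eq_three_of_not_isOfCMType hX3 hcm)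

/-! ### §3 The Hodge conjecture for powers of abelian threefolds -/

/-- **UNCONDITIONAL: the Hodge conjecture for every power `X^{N+1}` of every complex abelian threefold not of CM
type** (`B = D` on all powers and Lefschetz `(1,1)`). [cite: MoonenZarhin1999LowDim, Thm. 0.1 (4)] [cite: vanGeemen1994HodgeAV, §2.4 and Lemma 3.7] -/
theorem hodgeConjectureFor_powSucc_of_dim_eq_three_of_not_isOfCMType (hX3 : X.dim = 3) (hcm : ¬ IsOfCMType X)
    (N : ℕ) : HodgeConjectureFor (X.powSucc N).dim (X.powSucc N).X :=
  (isStablyNondegenerate_of_dim_eq_three_of_not_isOfCMType hX3 hcm).hodgeConjectureFor_powSucc N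

/-- **The Hodge conjecture for everything isogenous to a power of a non-CM abelian threefold**, unconditionally.
[cite: MoonenZarhin1999LowDim, Thm. 0.1 (4)] [cite: vanGeemen1994HodgeAV, Lemma 3.7] -/
theorem hodgeConjectureFor_of_isIsogenous_powSucc_of_dim_eq_three_of_not_isOfCMType (hX3 : X.dim = 3)
    (hcm : ¬ IsOfCMType X) {Y : AbelianVariety ℂ} {N : ℕ} (hY : AbelianVariety.IsIsogenous Y (X.powSucc N)) :
    HodgeConjectureFor Y.dim Y.X :=
  (isStablyNondegenerate_of_dim_eq_three_of_not_isOfCMType hX3 hcm).hodgeConjectureFor_of_isIsogenous_powSucc hY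

/-- **HC_CM ⟹ the Hodge conjecture for every power `X^{N+1}` of EVERY complex abelian threefold** (the cell's
framing: the non-CM threefolds are unconditional by §2; for `X` of CM type every `X^{N+1}` is of CM type —
`isOfCMType_powSucc` — and HC_CM, in Milne's per-variety form `∀ Y, CMHodgeHypothesisAt Y`, is applied to it;
nothing else is used). [cite: MoonenZarhin1999LowDim, Thm. 0.1 (4)] [cite: Milne1999, §7 p. 72] -/
theorem hodgeConjectureFor_powSucc_of_dim_eq_three_of_cmHodgeHypothesis
    (hCM : ∀ Y : AbelianVariety ℂ, CMHodgeHypothesisAt Y) (hX3 : X.dim = 3) (N : ℕ) :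
    HodgeConjectureFor (X.powSucc N).dim (X.powSucc N).X := by
  by_cases hcm : IsOfCMType X
  · exact hCM (X.powSucc N) Motives.AbelianVariety.isSmoothProjective_holds (isOfCMType_powSucc hcm N)
  · exact hodgeConjectureFor_powSucc_of_dim_eq_three_of_not_isOfCMType hX3 hcm N

/-! ### §4 The CM row discharged: EVERY complex abelian threefold is stably nondegenerate -/

/-- **MOONEN–ZARHIN Thm. 0.1 (4) IN DIMENSION 3: every complex abelian threefold is stably nondegenerate** —
`B•(Xⁿ) = D•(Xⁿ)` for all `n` («for every complex abelian variety `X` of dimension `≤ 3` we have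
`Hg(X) = Sp_D(V,φ)` and condition (D) in (2.3) is satisfied», (5.2)).  The displayed hypothesis `hR19` of
`isStablyNondegenerate_of_dim_eq_three_of` is the tree's
`isStablyNondegenerate_cmCurve_prod_of_isSimple_surface_of_isOfCMType` (Prop. (3.8) with (5.2), CM case).
[cite: MoonenZarhin1999LowDim, Thm. 0.1 (4) and (5.2)] [cite: MumfordAV1970, §19 Thm. 1 (pp. 173–174)] -/
theorem isStablyNondegenerate_of_dim_eq_three (hX3 : X.dim = 3) : IsStablyNondegenerate X :=
  isStablyNondegenerate_of_dim_eq_three_of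
    (fun _ _ hE hS2 hS hEcm hScm =>
      isStablyNondegenerate_cmCurve_prod_of_isSimple_surface_of_isOfCMType hE hEcm hS hS2 hScm) hX3

/-- **Every complex abelian variety of dimension `1`, `2` or `3` is stably nondegenerate** (dimension `1`:
`EllipticCurve.isStablyNondegenerate`; `2`: `AbelianVariety.isStablyNondegenerate_of_isSimple_surface` /
`isStablyNondegenerate_surface_of_not_isSimple`; `3`: the previous theorem) — «If `dim(X) ≤ 3` then every Hodge
class on `X` is a linear combination of products of divisor classes», for `X` and all its powers.
[cite: MoonenZarhin1999LowDim, Thm. 0.1 (4), (5.2) and Introduction (p. 1)] [cite: vanGeemen1994HodgeAV, Thm. 4.3] -/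
theorem isStablyNondegenerate_of_dim_pos_of_dim_le_three (h0 : 0 < X.dim) (h3 : X.dim ≤ 3) :
    IsStablyNondegenerate X := by
  rcases Nat.lt_or_ge X.dim 2 with h1 | h2
  · exact EllipticCurve.isStablyNondegenerate (by omega)
  rcases Nat.lt_or_ge X.dim 3 with h2' | h3'
  · by_cases hs : X.IsSimple
    · exact AbelianVariety.isStablyNondegenerate_of_isSimple_surface X hs (by omega)
    · exact isStablyNondegenerate_surface_of_not_isSimple (by omega) hs
  · exact isStablyNondegenerate_of_dim_eq_three (by omega)

/-- **The Hodge conjecture for every power `X^{N+1}` of every complex abelian threefold — UNCONDITIONAL**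
(`B = D` on all powers and Lefschetz `(1,1)`; no HC_CM: this supersedes
`hodgeConjectureFor_powSucc_of_dim_eq_three_of_cmHodgeHypothesis`). [cite: MoonenZarhin1999LowDim, Thm. 0.1 (4)]
[cite: vanGeemen1994HodgeAV, §2.4 and Lemma 3.7] -/
theorem hodgeConjectureFor_powSucc_of_dim_eq_three (hX3 : X.dim = 3) (N : ℕ) :
    HodgeConjectureFor (X.powSucc N).dim (X.powSucc N).X :=
  (isStablyNondegenerate_of_dim_eq_three hX3).hodgeConjectureFor_powSucc N

/-- **The Hodge conjecture for every complex abelian threefold** (the case `N = 0`; classically Lefschetz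
`(1,1)` with Poincaré duality). [cite: MoonenZarhin1999LowDim, Thm. 0.1 (4) and Introduction (p. 1)] -/
theorem hodgeConjectureFor_of_dim_eq_three (hX3 : X.dim = 3) : HodgeConjectureFor X.dim X.X :=
  (isStablyNondegenerate_of_dim_eq_three hX3).hodgeConjectureFor

/-- **The Hodge conjecture for everything isogenous to a power of a complex abelian threefold**, unconditionally.
[cite: MoonenZarhin1999LowDim, Thm. 0.1 (4)] [cite: vanGeemen1994HodgeAV, Lemma 3.7] -/
theorem hodgeConjectureFor_of_isIsogenous_powSucc_of_dim_eq_three (hX3 : X.dim = 3) {Y : AbelianVariety ℂ}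
    {N : ℕ} (hY : AbelianVariety.IsIsogenous Y (X.powSucc N)) : HodgeConjectureFor Y.dim Y.X :=
  (isStablyNondegenerate_of_dim_eq_three hX3).hodgeConjectureFor_of_isIsogenous_powSucc hY

/-- **The Hodge conjecture for every power of every complex abelian variety of dimension `1`, `2` or `3`**,
unconditionally. [cite: MoonenZarhin1999LowDim, Thm. 0.1 (4) and Introduction (p. 1)] -/
theorem hodgeConjectureFor_powSucc_of_dim_pos_of_dim_le_three (h0 : 0 < X.dim) (h3 : X.dim ≤ 3) (N : ℕ) :
    HodgeConjectureFor (X.powSucc N).dim (X.powSucc N).X :=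
  (isStablyNondegenerate_of_dim_pos_of_dim_le_three h0 h3).hodgeConjectureFor_powSucc N

end Literature.AlgebraicGeometry.HodgeTheory
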